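import Summits.CriticalPhenomena.PercolationContinuityZ3.Theorems.SahiRandomClusterLimits
import Summits.CriticalPhenomena.PercolationContinuityZ3.Theorems.SahiBoxTP2HilbertFewCoordinates

/-!
# Functions of three fixed edges under a box-TP₂ law of random sets / under `φ^b_{p,q}`: `E_n ≥ 0` for EVERY `n`,
# unconditionally

Support file of the Sahi cell (`prim-sahi`, typer seat, generation 16; `--supports stmt-CriticalPhenomena-4575`).
Theorems only (no definitions, no named facts, no sorries).  Transport of generation 12's
`msahiE_nonneg_of_isBoxTP2_spins_comp_three` (box-TP₂ laws on `{0,1}^ι`: functions of the same three coordinates have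
`E_n ≥ 0` for every `n`, because the three-coordinate marginal is an FKG weight on `{0,1}³`, where Sahi's conjecture
holds at every order) along `setBoolIso : Set ι ≃o (ι → Bool)`:

* `msahiE_nonneg_of_isBoxTP2_set_comp_three` — for a box-TP₂ probability measure on `Set ι` and monotone nonnegative
  `g_i : (Fin 3 → Bool) → ℝ`: `0 ≤ E_n(ω ↦ g_i([j₀ ∈ ω], [j₁ ∈ ω], [j₂ ∈ ω]))`, every `n`;
* **`isRandomClusterLimit_msahiE_nonneg_threeEdges`** — the same for the limit random-cluster measures `φ^b_{p,q}` of
  `ℤ^d` (`0 ≤ p ≤ 1`, `q ≥ 1`): monotone functions of the states of three fixed edges are Sahi-positive of EVERY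
  order, unconditionally — the infinite-volume form of generation 4's `rc_sahiE_threeEdges_nonneg`.

No sorries, no new axioms.
-/

noncomputable section

namespace Summit.CriticalPhenomena.PercolationContinuityZ3.Theorems.SahiBoxTP2

open MeasureTheory Set Function Literature.Combinatorics.Sahi2008
open Literature.Probability.LatticeModels Literature.Probability.Percolation
open scoped ENNReal

section SetThree

variable {ι : Type*} {n : ℕ}

/-- **Functions of three fixed coordinates of a box-TP₂ law of random sets have `E_n ≥ 0` for every `n`**
(unconditional). [this work] -/
theorem msahiE_nonneg_of_isBoxTP2_set_comp_three (μ : Measure (Set ι)) [IsProbabilityMeasure μ] (hμ : IsBoxTP2 μ)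
    {j : Fin 3 → ι} (hj : Injective j) (g : Fin n → (Fin 3 → Bool) → ℝ) (hg0 : ∀ i x, 0 ≤ g i x)
    (hmono : ∀ i, Monotone (g i)) : 0 ≤ msahiE μ n (fun i ω => g i (setBoolIso ω ∘ j)) := by
  haveI : IsProbabilityMeasure (μ.map (setBoolIso (ι := ι))) :=
    Measure.isProbabilityMeasure_map measurable_setBoolIso.aemeasurable
  have key := msahiE_nonneg_of_isBoxTP2_spins_comp_three (μ.map (setBoolIso (ι := ι)))
    ((isBoxTP2_iff_map_setBoolIso μ).2 hμ) hj g hg0 hmono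
  have h := msahiE_comp_measurePreserving (measurePreserving_setBoolIso_symm μ) measurableEmbedding_setBoolIso_symm n
    (fun i ω => g i (setBoolIso ω ∘ j))
  have e : (fun i => (fun ω : Set ι => g i (setBoolIso ω ∘ j)) ∘ (setBoolIso (ι := ι)).symm) =
      fun i u => g i (u ∘ j) := by
    funext i u
    simp only [Function.comp_apply, OrderIso.apply_symm_apply]
  rw [e] at h
  rw [h] at key
  exact key

end SetThree

section Limit

variable {d : ℕ} {b : RCBoundary} {p q : ℝ} {P : Measure (BondConfig (Site d))} {n : ℕ}

/-- **Monotone functions of the states of three fixed edges are Sahi-positive of EVERY order under `φ^b_{p,q}`**,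
unconditionally (`0 ≤ p ≤ 1`, `q ≥ 1`): `0 ≤ E_n(g_0(ω_{e₀},ω_{e₁},ω_{e₂}), …, g_{n−1}(ω_{e₀},ω_{e₁},ω_{e₂}))`. [this work] -/
theorem isRandomClusterLimit_msahiE_nonneg_threeEdges (hP : IsRandomClusterLimit d b p q P) (hp : p ∈ Set.Icc (0 : ℝ) 1)
    (hq : 1 ≤ q) (e : Sym2 (Site d) ≃ ℕ) {j : Fin 3 → Sym2 (Site d)} (hj : Injective j)
    (g : Fin n → (Fin 3 → Bool) → ℝ) (hg0 : ∀ i x, 0 ≤ g i x) (hmono : ∀ i, Monotone (g i)) :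
    0 ≤ msahiE P n (fun i ω => g i (setBoolIso ω ∘ j)) := by
  haveI := hP.isProbabilityMeasure
  exact msahiE_nonneg_of_isBoxTP2_set_comp_three P (isRandomClusterLimit_isBoxTP2 hP hp hq e) hj g hg0 hmono

end Limit

end Summit.CriticalPhenomena.PercolationContinuityZ3.Theorems.SahiBoxTP2
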